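import Literature.AlgebraicGeometry.Frobenioids.ArchimedeanSlitRegion
import HarnessLib

/-!
# Frobenioids II, Definition 3.1 (iii): small open arcs of `S¹` as angular parts

Mochizuki, *The geometry of Frobenioids II: poly-Frobenioids*, Kyushu J. Math. **62** (2008)
401–460, §3, Definition 3.1 (iii) p. 24 (angular regions `A = B × (0, λ]`, `B ⊆ O_K^×` open with
connected nonempty trace on each connected component) and Remark 3.3.1 / Remark 3.4.1 pp. 29, 33
(arguments "by using angular regions" that are suitable arcs) [cite: MochizukiFrdII2008, Def 3.1 (iii) p.24].

This file constructs, for a direction `w ∈ S¹ = O_ℂ^×` and `0 < ε < π`, the angular region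
`arcRegion w ε t` whose angular part is the open arc `arcDir w ε = {z | arg(z w⁻¹) ∈ (−ε, ε)}` around
`w` (open: `arg` is continuous off the negative real axis; connected: the image of `(−ε, ε)` under
`θ ↦ w · e^{iθ}`), shows that every open subset of `S¹` containing `w` contains such an arc
(`exists_arcDir_subset`), and that arcs rotate (`mem_arcDir_mul_iff`). These "narrow" objects are the
test objects of Remark 3.3.1 (monomorphisms are injective on angular regions). Builds on
`ArchimedeanSlitRegion.lean` (`expUnit`, connectedness of `S¹`).
-/

namespace Literature.AlgebraicGeometry.Frobenioids

open Complex Topology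

noncomputable section

namespace ArchFrd

/-- `e^{i·0} = 1`. [cite: MochizukiFrdII2008, Def 3.1 (ii) p.23] -/
@[simp] theorem expUnit_zero : expUnit 0 = 1 := by
  apply Subtype.ext; apply Units.ext
  rw [coe_expUnit]
  simp

/-- The relative angle of `z` with respect to `w`: `arg(z · w⁻¹) ∈ (−π, π]`.
[cite: MochizukiFrdII2008, Def 3.1 (iii) p.24] -/
def relArg (w z : normOneSubgroup ℂ) : ℝ := arg (((z * w⁻¹ : normOneSubgroup ℂ) : ℂˣ) : ℂ)

/-- `relArg w (w · e^{iθ}) = θ` for `θ ∈ (−π, π]`. [cite: MochizukiFrdII2008, Def 3.1 (iii) p.24] -/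
theorem relArg_mul_expUnit (w : normOneSubgroup ℂ) {θ : ℝ} (hθ : θ ∈ Set.Ioc (-Real.pi) Real.pi) :
    relArg w (w * expUnit θ) = θ := by
  unfold relArg
  rw [mul_inv_cancel_comm]
  exact arg_coe_expUnit hθ

/-- `w · e^{i · relArg w z} = z`. [cite: MochizukiFrdII2008, Def 3.1 (iii) p.24] -/
theorem mul_expUnit_relArg (w z : normOneSubgroup ℂ) : w * expUnit (relArg w z) = z := by
  unfold relArg
  rw [expUnit_arg, mul_comm, inv_mul_cancel_right]

/-- Relative angles are rotation invariant: `relArg (u w) (u z) = relArg w z`.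
[cite: MochizukiFrdII2008, Def 3.1 (iii) p.24] -/
theorem relArg_mul_left (u w z : normOneSubgroup ℂ) : relArg (u * w) (u * z) = relArg w z := by
  unfold relArg
  rw [mul_inv_rev, ← mul_assoc, mul_assoc u z, mul_inv_cancel_comm]

/-- The open arc of half-width `ε` around `w`: `{z ∈ S¹ | arg(z w⁻¹) ∈ (−ε, ε)}`.
[cite: MochizukiFrdII2008, Def 3.1 (iii) p.24] -/
def arcDir (w : normOneSubgroup ℂ) (ε : ℝ) : Set (normOneSubgroup ℂ) :=
  {z | relArg w z ∈ Set.Ioo (-ε) ε}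

/-- `w` lies in every arc around `w`. [cite: MochizukiFrdII2008, Def 3.1 (iii) p.24] -/
theorem mem_arcDir_self (w : normOneSubgroup ℂ) {ε : ℝ} (hε : 0 < ε) : w ∈ arcDir w ε := by
  change relArg w w ∈ Set.Ioo (-ε) ε
  have h : relArg w w = 0 := by
    have := relArg_mul_expUnit w (θ := 0) ⟨by linarith [Real.pi_pos], Real.pi_pos.le⟩
    rwa [expUnit_zero, mul_one] at this
  rw [h]
  exact ⟨by linarith, hε⟩

/-- Arcs rotate: `u z ∈ arcDir (u w) ε ↔ z ∈ arcDir w ε`. [cite: MochizukiFrdII2008, Def 3.1 (iii) p.24] -/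
theorem mem_arcDir_mul_iff (u w z : normOneSubgroup ℂ) (ε : ℝ) :
    u * z ∈ arcDir (u * w) ε ↔ z ∈ arcDir w ε := by
  change relArg (u * w) (u * z) ∈ Set.Ioo (-ε) ε ↔ relArg w z ∈ Set.Ioo (-ε) ε
  rw [relArg_mul_left]

/-- The arc is the image of `(−ε, ε)` under `θ ↦ w · e^{iθ}` (for `0 < ε < π`).
[cite: MochizukiFrdII2008, Def 3.1 (iii) p.24] -/
theorem arcDir_eq_image (w : normOneSubgroup ℂ) {ε : ℝ} (hεπ : ε < Real.pi) :
    arcDir w ε = (fun θ => w * expUnit θ) '' Set.Ioo (-ε) ε := by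
  ext z
  constructor
  · intro hz
    exact ⟨relArg w z, hz, mul_expUnit_relArg w z⟩
  · rintro ⟨θ, hθ, rfl⟩
    change relArg w (w * expUnit θ) ∈ Set.Ioo (-ε) ε
    rw [relArg_mul_expUnit w ⟨by linarith [hθ.1], by linarith [hθ.2]⟩]
    exact hθ

/-- `θ ↦ w · e^{iθ}` is continuous. [cite: MochizukiFrdII2008, Def 3.1 (iii) p.24] -/
theorem continuous_mul_expUnit (w : normOneSubgroup ℂ) : Continuous fun θ : ℝ => w * expUnit θ :=
  continuous_const.mul continuous_expUnit

/-- Arcs are connected. [cite: MochizukiFrdII2008, Def 3.1 (iii) p.24] -/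
theorem isConnected_arcDir (w : normOneSubgroup ℂ) {ε : ℝ} (hε : 0 < ε) (hεπ : ε < Real.pi) :
    IsConnected (arcDir w ε) := by
  rw [arcDir_eq_image w hεπ]
  exact (isConnected_Ioo (by linarith : -ε < ε)).image _ (continuous_mul_expUnit w).continuousOn

/-- Arcs (of half-width `< π`) are open: `arg` is continuous at every point of the arc, which avoids
the negative real axis. [cite: MochizukiFrdII2008, Def 3.1 (iii) p.24] -/
theorem isOpen_arcDir (w : normOneSubgroup ℂ) {ε : ℝ} (hεπ : ε < Real.pi) : IsOpen (arcDir w ε) := by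
  rw [isOpen_iff_mem_nhds]
  intro z hz
  have hval : Continuous fun y : normOneSubgroup ℂ => (((y * w⁻¹ : normOneSubgroup ℂ) : ℂˣ) : ℂ) :=
    Units.continuous_val.comp (continuous_subtype_val.comp (continuous_id.mul continuous_const))
  have hq : (((z * w⁻¹ : normOneSubgroup ℂ) : ℂˣ) : ℂ) ∈ slitPlane := by
    rw [mem_slitPlane_iff]
    by_contra hn
    obtain ⟨h1, h2⟩ := not_or.mp hn
    have h1' : (((z * w⁻¹ : normOneSubgroup ℂ) : ℂˣ) : ℂ).re ≤ 0 := not_lt.mp h1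
    have h2' : (((z * w⁻¹ : normOneSubgroup ℂ) : ℂˣ) : ℂ).im = 0 := not_not.mp h2
    have hre : (((z * w⁻¹ : normOneSubgroup ℂ) : ℂˣ) : ℂ).re ≠ 0 := fun hre =>
      ((z * w⁻¹ : normOneSubgroup ℂ) : ℂˣ).ne_zero
        (Complex.ext (by rw [Complex.zero_re]; exact hre) (by rw [Complex.zero_im]; exact h2'))
    have hpi : arg (((z * w⁻¹ : normOneSubgroup ℂ) : ℂˣ) : ℂ) = Real.pi :=
      arg_eq_pi_iff.mpr ⟨lt_of_le_of_ne h1' hre, h2'⟩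
    have hlt : relArg w z < ε := hz.2
    unfold relArg at hlt
    linarith
  have hca := ContinuousAt.comp
    (f := fun y : normOneSubgroup ℂ => (((y * w⁻¹ : normOneSubgroup ℂ) : ℂˣ) : ℂ)) (g := arg)
    (continuousAt_arg hq) hval.continuousAt
  exact hca.preimage_mem_nhds (isOpen_Ioo.mem_nhds hz)

/-- The **arc region** around `w` of half-width `ε ∈ (0, π)` and tip `t`: an angular region of `ℂ^×`
in the sense of Def. 3.1 (iii). [cite: MochizukiFrdII2008, Def 3.1 (iii) p.24] -/
def arcRegion (w : normOneSubgroup ℂ) (ε : ℝ) (hε : 0 < ε) (hεπ : ε < Real.pi) (t : PosReal) :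
    AngularRegion ℂ where
  dir := arcDir w ε
  tip := t
  isOpen_dir := isOpen_arcDir w hεπ
  isConnected_inter z := by
    rw [connectedComponent_eq_univ' z, Set.inter_univ]
    exact isConnected_arcDir w hε hεπ

/-- The angular part of an arc region. [cite: MochizukiFrdII2008, Def 3.1 (iii) p.24] -/
@[simp] theorem arcRegion_dir (w : normOneSubgroup ℂ) (ε : ℝ) (hε : 0 < ε) (hεπ : ε < Real.pi)
    (t : PosReal) : (arcRegion w ε hε hεπ t).dir = arcDir w ε := rfl

/-- The tip of an arc region. [cite: MochizukiFrdII2008, Def 3.1 (iii) p.24] -/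
@[simp] theorem arcRegion_tip (w : normOneSubgroup ℂ) (ε : ℝ) (hε : 0 < ε) (hεπ : ε < Real.pi)
    (t : PosReal) : (arcRegion w ε hε hεπ t).tip = t := rfl

/-- Every open `U ⊆ S¹` containing `w` contains a whole arc around `w` (of half-width `< π`).
[cite: MochizukiFrdII2008, Def 3.1 (iii) p.24] -/
theorem exists_arcDir_subset {U : Set (normOneSubgroup ℂ)} (hU : IsOpen U) {w : normOneSubgroup ℂ}
    (hw : w ∈ U) : ∃ ε : ℝ, 0 < ε ∧ ε < Real.pi ∧ arcDir w ε ⊆ U := by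
  have hc := continuous_mul_expUnit w
  have hmem : (fun θ : ℝ => w * expUnit θ) ⁻¹' U ∈ 𝓝 (0 : ℝ) := by
    apply hc.continuousAt.preimage_mem_nhds
    have h0 : w * expUnit 0 = w := by rw [expUnit_zero, mul_one]
    rw [h0]
    exact hU.mem_nhds hw
  obtain ⟨δ, hδ, hball⟩ := Metric.mem_nhds_iff.mp hmem
  have hm : 0 < min (δ / 2) (Real.pi / 2) := lt_min (by linarith) (by linarith [Real.pi_pos])
  have hmπ : min (δ / 2) (Real.pi / 2) < Real.pi :=
    lt_of_le_of_lt (min_le_right _ _) (by linarith [Real.pi_pos])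
  refine ⟨min (δ / 2) (Real.pi / 2), hm, hmπ, ?_⟩
  rw [arcDir_eq_image w hmπ]
  rintro _ ⟨θ, hθ, rfl⟩
  apply hball
  rw [Metric.mem_ball, Real.dist_eq, sub_zero, abs_lt]
  have h1 := min_le_left (δ / 2) (Real.pi / 2)
  constructor <;> linarith [hθ.1, hθ.2]

end ArchFrd

end

end Literature.AlgebraicGeometry.Frobenioids
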